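import Mathlib
import HarnessLib
import Summits.AtomisticToContinuum.FouriersLaw.Theses.JunctionLocality
import Summits.AtomisticToContinuum.FouriersLaw.Theses.FeketeSeriesLaw
import Summits.AtomisticToContinuum.FouriersLaw.Theses.SpatialCentreManifold
import Literature.MathematicalPhysics.KineticTheory.LangevinChainNESSHolds
import Summits.AtomisticToContinuum.FouriersLaw.Theorems.JunctionLocalityJunctionDichotomy
import Summits.AtomisticToContinuum.FouriersLaw.Theorems.JunctionLocalitySuperadditiveResistanceStubLinearResponsePlain
import Summits.AtomisticToContinuum.FouriersLaw.Theorems.JunctionLocalitySuperadditiveResistanceOfAffineResistanceLaw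
import Summits.AtomisticToContinuum.FouriersLaw.Theorems.JunctionLocalitySuperadditiveResistanceCruxPositionQuasiSubadditive
import Summits.AtomisticToContinuum.FouriersLaw.Theorems.JunctionLocalitySuperadditiveResistanceCruxPositionNonBallistic
import Summits.AtomisticToContinuum.FouriersLaw.Theorems.JunctionLocalitySuperadditiveResistanceCruxPositionConductanceLowerBound

/-!
# Crux position: the four Fekete halves are jointly the affine resistance law (hard direction)
(crux `JunctionLocality.SuperadditiveResistance`, stmt-AtomisticToContinuum-11748; helper `--supports` it; lead c7, 2026-08-17)

Over the weak-NESS shell of `pinnedChain ω₂ lam β γ` (all parameters `> 0`) the tree carries four `N`-uniform statements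
about the response coefficients `D_N` and the resistances `R_N := (N−1)/D_N`:

* (A)  `JunctionLocality.SuperadditiveResistance` (stmt-11748): `R_N + R_M − C ≤ R_{N+M}`;
* (A') `FeketeSeriesLaw.QuasiSubadditiveResistance` (stmt-14041): `R_{N+M} ≤ R_N + R_M + C`;
* (B)  `JunctionLocality.NonBallistic` (stmt-9127): `D_N ≤ ε(N−1)` frequently, every `ε > 0`;
* (C)  `JunctionLocality.ConductanceLowerBound` (stmt-11749): `D_N ≥ c > 0` eventually;

and route `SpatialCentreManifold` carries the affine resistance law `AffineResistanceLaw` (stmt-13407):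
`∃ r > 0 ∀ family ∀ D ∃ C ∀ N, |R_N − (N−1)·r| ≤ C`.

This file proves the hard direction `(A) → (A') → (B) → (C) → AffineResistanceLaw`
(`affineResistanceLaw_of_fourHalves`) and assembles the equivalence `affineResistanceLaw_iff_fourHalves`:
**stmt-13407 ⟺ stmt-11748 ∧ stmt-14041 ∧ stmt-9127 ∧ stmt-11749** in the kernel — one open `N`-uniform statement
(Fourier's law with the `1/N` finite-size rate, BonettoLebowitzReyBellet2000 §6.3) carried by four items of three routes.
Proof of the hard direction: along the CANONICAL steady-state family (existence:
`pinnedChain_exists_isSteadyState`; junk `0` at non-positive temperatures) and its response coefficients `D₀`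
(`finiteResponseOfUnique_proof`), positivity (`positiveConductance_proof`) and (A) ∧ (A') give two-sided junction locality,
so the landed `junctionDichotomy_proof` yields either `|D₀ N − κ| ≤ K/N` with `κ > 0` or a ballistic floor
`D₀ N ≥ (N−1)/C_d`; (B) excludes the floor; in the Fourier branch `r := 1/κ` and
`|R_N − (N−1)/κ| = (N−1)|κ − D₀ N|/(κ D₀ N) ≤ K/(κ D₀ N)`, bounded by `K/(κ c)` beyond the threshold of (C) and by a
finite sum before it (`N = 0, 1` contribute two fixed numbers). Weak-NESS uniqueness makes every other steady-state
family agree with the canonical one at positive temperatures, so its response coefficients coincide with `D₀`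
(uniqueness of limits along `𝓝[≠] 0`) and the same `r`, chosen BEFORE the family as the statement demands, serves.
The easy conversions `AffineResistanceLaw → (A), (A'), (B), (C)` are the landed
`OfAffineResistanceLaw.superadditiveResistance_of_affineResistanceLaw`, `quasiSubadditiveResistance_of_affineResistanceLaw`,
`nonBallistic_of_affineResistanceLaw`, `conductanceLowerBound_of_affineResistanceLaw` (wave 1 of lead c7).
Standard axioms; no named fact is taken.
-/

noncomputable section

open MeasureTheory Filter Topology
open Literature.MathematicalPhysics.KineticTheory.HeatConduction

namespace Summit.AtomisticToContinuum.FouriersLaw.Cruxes.SuperadditiveResistance.CruxPosition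

/-- **Pointwise affine deviation from the `1/N` rate.** If `0 < d`, `0 < κ`, `0 ≤ K`, `2 ≤ n` and `|d − κ| ≤ K/n`,
then `|(n−1)/d − (n−1)·(1/κ)| ≤ K/(κ d)` (indeed `= (n−1)|κ − d|/(κ d) ≤ ((n−1)/n)·K/(κ d)`). -/
theorem affine_dev_le {d κ K n : ℝ} (hd : 0 < d) (hκ : 0 < κ) (hK : 0 ≤ K) (hn : 2 ≤ n)
    (h : |d - κ| ≤ K / n) : |(n - 1) / d - (n - 1) * (1 / κ)| ≤ K / (κ * d) := by
  have hn1 : 0 ≤ n - 1 := by linarith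
  have hn0 : 0 < n := by linarith
  have h' : |κ - d| ≤ K / n := by rwa [abs_sub_comm]
  have key : (n - 1) * |κ - d| ≤ K := by
    have h1 : (n - 1) * |κ - d| ≤ (n - 1) * (K / n) := mul_le_mul_of_nonneg_left h' hn1
    have h2 : (n - 1) * (K / n) ≤ n * (K / n) :=
      mul_le_mul_of_nonneg_right (by linarith) (div_nonneg hK hn0.le)
    have h3 : n * (K / n) = K := by field_simp
    linarith
  have e : (n - 1) / d - (n - 1) * (1 / κ) = (n - 1) * (κ - d) / (κ * d) := by
    field_simp
  rw [e, abs_div, abs_mul, abs_of_nonneg hn1, abs_of_pos (mul_pos hκ hd)]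
  exact div_le_div_of_nonneg_right key (mul_pos hκ hd).le

/-- **`(A) → (A') → (B) → (C) → AffineResistanceLaw`** — the four Fekete halves of routes JunctionLocality /
FeketeSeriesLaw jointly give route SpatialCentreManifold's affine resistance law (Fourier's law with the `1/N` rate),
given the PROVED fixed-`N` package (existence and weak uniqueness of the steady state, existence and positivity of the
response coefficients). See the module docstring for the proof. -/
theorem affineResistanceLaw_of_fourHalves :
    Summit.AtomisticToContinuum.FouriersLaw.Theses.JunctionLocality.SuperadditiveResistance →
    Summit.AtomisticToContinuum.FouriersLaw.Theses.FeketeSeriesLaw.QuasiSubadditiveResistance →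
    Summit.AtomisticToContinuum.FouriersLaw.Theses.JunctionLocality.NonBallistic →
    Summit.AtomisticToContinuum.FouriersLaw.Theses.JunctionLocality.ConductanceLowerBound →
    Summit.AtomisticToContinuum.FouriersLaw.Theses.SpatialCentreManifold.AffineResistanceLaw := by
  intro hA hA' hB hC ω₂ lam β γ hω hl hβ hγ hU T hT
  classical
  -- (1) the canonical steady-state family (junk `0` outside positive temperatures)
  let μ₀ : (N : ℕ) → ℝ → ℝ → Measure (PhaseSpace N) := fun N a b =>
    if hab : 0 < a ∧ 0 < b then
      Classical.choose (pinnedChain_exists_isSteadyState hω hl hβ hγ N hab.1 hab.2)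
    else 0
  have hμ₀ : ∀ (N : ℕ) (a b : ℝ), 0 < a → 0 < b →
      (pinnedChain ω₂ lam β γ).IsSteadyState N a b (μ₀ N a b) := by
    intro N a b ha hb
    simp only [μ₀, dif_pos (And.intro ha hb)]
    exact Classical.choose_spec (pinnedChain_exists_isSteadyState hω hl hβ hγ N ha hb)
  -- (2) its response coefficients, positive from length 2 on
  have hDex := ThermaliseThenCutProbeInsertion.finiteResponseOfUnique_proof
    ω₂ lam β γ hω hl hβ hγ hU μ₀ hμ₀ T hT
  choose D₀ hD₀ using hDex
  have hpos₀ : ∀ N : ℕ, 2 ≤ N → 0 < D₀ N :=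
    ThermaliseThenCutProbeInsertion.positiveConductance_proof
      ω₂ lam β γ hω hl hβ hγ hU μ₀ hμ₀ T hT D₀ hD₀
  -- (3) two-sided junction locality along the canonical family
  obtain ⟨C₁, hC₁⟩ := hA ω₂ lam β γ hω hl hβ hγ hU μ₀ hμ₀ T hT D₀ hD₀ hpos₀
  obtain ⟨C₂, hC₂⟩ := hA' ω₂ lam β γ hω hl hβ hγ hU μ₀ hμ₀ T hT D₀ hD₀
  set Cd : ℝ := |C₁| + |C₂| + 1 with hCd_def
  have hCd : 0 < Cd := by positivity
  have htwo : ∀ N M : ℕ, 2 ≤ N → 2 ≤ M →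
      |((N : ℝ) + (M : ℝ) - 1) / D₀ (N + M) - ((N : ℝ) - 1) / D₀ N - ((M : ℝ) - 1) / D₀ M| ≤ Cd := by
    intro N M hN hM
    have h1 := hC₁ N M hN hM
    have h2 := hC₂ N M hN hM
    have eN : ((N - 1 : ℕ) : ℝ) = (N : ℝ) - 1 := by
      rw [Nat.cast_sub (show 1 ≤ N by omega), Nat.cast_one]
    have eM : ((M - 1 : ℕ) : ℝ) = (M : ℝ) - 1 := by
      rw [Nat.cast_sub (show 1 ≤ M by omega), Nat.cast_one]
    have eNM : ((N + M - 1 : ℕ) : ℝ) = (N : ℝ) + (M : ℝ) - 1 := by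
      rw [Nat.cast_sub (show 1 ≤ N + M by omega), Nat.cast_add, Nat.cast_one]
    rw [eN, eM, eNM] at h2
    rw [abs_le]
    constructor
    · linarith [le_abs_self C₁, abs_nonneg C₂, hCd_def]
    · linarith [le_abs_self C₂, abs_nonneg C₁, hCd_def]
  -- (4) the dichotomy; (B) kills the ballistic branch
  rcases Summit.AtomisticToContinuum.FouriersLaw.Theorems.junctionDichotomy_proof D₀ Cd hpos₀ htwo with
    ⟨κ, K, hκ, hK⟩ | hball
  swap
  · exfalso
    obtain ⟨N, hN2, hDN⟩ :=
      hB ω₂ lam β γ hω hl hβ hγ hU μ₀ hμ₀ T hT D₀ hD₀ (1 / (2 * Cd)) (by positivity) 2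
    have h1 := hball N hN2
    have hN1 : (0 : ℝ) < (N : ℝ) - 1 := by
      have : (2 : ℝ) ≤ (N : ℝ) := by exact_mod_cast hN2
      linarith
    have h3 : ((N : ℝ) - 1) / Cd ≤ 1 / (2 * Cd) * ((N : ℝ) - 1) := h1.trans hDN
    rw [div_le_iff₀ hCd] at h3
    have e : 1 / (2 * Cd) * ((N : ℝ) - 1) * Cd = ((N : ℝ) - 1) / 2 := by
      field_simp
    rw [e] at h3
    linarith
  -- (5) the Fourier branch: `r := 1/κ`, chosen before the family
  have hK0 : 0 ≤ K := by
    have h2 := (abs_nonneg _).trans (hK 2 le_rfl)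
    have : (0 : ℝ) ≤ K / 2 := by simpa using h2
    linarith
  obtain ⟨c, hc, N₁, hN₁⟩ := hC ω₂ lam β γ hω hl hβ hγ hU μ₀ hμ₀ T hT D₀ hD₀
  refine ⟨1 / κ, by positivity, ?_⟩
  intro μ hμ D hD
  -- every steady-state family has the canonical response coefficients
  have hDD : D = D₀ := by
    funext N
    refine tendsto_nhds_unique ((hD N).congr' ?_) (hD₀ N)
    have h2 : ∀ᶠ δ in 𝓝 (0 : ℝ), δ < 2 * T := eventually_lt_nhds (by linarith)
    have h2' : ∀ᶠ δ in 𝓝 (0 : ℝ), -(2 * T) < δ := eventually_gt_nhds (by linarith)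
    filter_upwards [mem_nhdsWithin_of_mem_nhds h2, mem_nhdsWithin_of_mem_nhds h2'] with δ hlt hgt
    have ha : 0 < T + δ / 2 := by linarith
    have hb : 0 < T - δ / 2 := by linarith
    rw [hU N _ _ ha hb (μ N _ _) (μ₀ N _ _) (hμ N _ _ ha hb) (hμ₀ N _ _ ha hb)]
  rw [hDD]
  -- the constant: two fixed numbers (N = 0, 1), a finite sum (2 ≤ N < N₁), and K/(κ c) beyond
  set e : ℕ → ℝ := fun N => |((N : ℝ) - 1) / D₀ N - ((N : ℝ) - 1) * (1 / κ)| with he_def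
  have he0 : ∀ N, 0 ≤ e N := fun N => abs_nonneg _
  set Sfin : ℝ := ∑ n ∈ Finset.range N₁, |K / (κ * D₀ n)| with hSfin_def
  have hSfin0 : 0 ≤ Sfin := Finset.sum_nonneg fun n _ => abs_nonneg _
  have hKc0 : 0 ≤ K / (κ * c) := div_nonneg hK0 (mul_pos hκ hc).le
  refine ⟨e 0 + e 1 + Sfin + K / (κ * c), fun N => ?_⟩
  show e N ≤ e 0 + e 1 + Sfin + K / (κ * c)
  rcases Nat.lt_or_ge N 2 with hN | hN
  · interval_cases N
    · linarith [he0 1]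
    · linarith [he0 0]
  · -- N ≥ 2: the 1/N rate gives the pointwise bound K/(κ D₀ N)
    have hNr : (2 : ℝ) ≤ (N : ℝ) := by exact_mod_cast hN
    have hmain : e N ≤ K / (κ * D₀ N) :=
      affine_dev_le (hpos₀ N hN) hκ hK0 hNr (hK N hN)
    rcases Nat.lt_or_ge N N₁ with hN₁' | hN₁'
    · -- before the threshold of (C): one term of the finite sum
      have hterm : K / (κ * D₀ N) ≤ Sfin := by
        have h1 : K / (κ * D₀ N) ≤ |K / (κ * D₀ N)| := le_abs_self _
        have h2 : |K / (κ * D₀ N)| ≤ Sfin :=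
          Finset.single_le_sum (f := fun n => |K / (κ * D₀ n)|) (fun i _ => abs_nonneg _)
            (Finset.mem_range.mpr hN₁')
        exact h1.trans h2
      linarith [he0 0, he0 1]
    · -- beyond the threshold: D₀ N ≥ c
      have hcN : c ≤ D₀ N := hN₁ N hN₁'
      have hterm : K / (κ * D₀ N) ≤ K / (κ * c) := by
        apply div_le_div_of_nonneg_left hK0 (mul_pos hκ hc)
        exact mul_le_mul_of_nonneg_left hcN hκ.le
      linarith [he0 0, he0 1]

/-- **Crux position (stmt-13407 ⟺ stmt-11748 ∧ stmt-14041 ∧ stmt-9127 ∧ stmt-11749).** Over the weak-NESS shell of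
`pinnedChain` (existence, weak uniqueness, response limits and their positivity all PROVED in the tree), route
SpatialCentreManifold's `AffineResistanceLaw` — Fourier's law with the `1/N` finite-size rate — is EQUIVALENT to the
conjunction of the four Fekete halves: the crux `JunctionLocality.SuperadditiveResistance` (A), its companion
`FeketeSeriesLaw.QuasiSubadditiveResistance` (A'), `JunctionLocality.NonBallistic` (B) and
`JunctionLocality.ConductanceLowerBound` (C). No single conjunct can be dropped: the pinned harmonic member satisfies
(A), (A'), (C) and violates (B) (`JunctionLocality.HarmonicCalibration`); `R_N = ℓN − b log N` satisfies (A) and violates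
(A') (Cruxes/…/Negative/KillCriteria). -/
theorem affineResistanceLaw_iff_fourHalves :
    Summit.AtomisticToContinuum.FouriersLaw.Theses.SpatialCentreManifold.AffineResistanceLaw ↔
    (Summit.AtomisticToContinuum.FouriersLaw.Theses.JunctionLocality.SuperadditiveResistance ∧
      Summit.AtomisticToContinuum.FouriersLaw.Theses.FeketeSeriesLaw.QuasiSubadditiveResistance ∧
      Summit.AtomisticToContinuum.FouriersLaw.Theses.JunctionLocality.NonBallistic ∧
      Summit.AtomisticToContinuum.FouriersLaw.Theses.JunctionLocality.ConductanceLowerBound) :=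
  ⟨fun h => ⟨OfAffineResistanceLaw.superadditiveResistance_of_affineResistanceLaw h,
    quasiSubadditiveResistance_of_affineResistanceLaw h, nonBallistic_of_affineResistanceLaw h,
    conductanceLowerBound_of_affineResistanceLaw h⟩,
    fun h => affineResistanceLaw_of_fourHalves h.1 h.2.1 h.2.2.1 h.2.2.2⟩

end Summit.AtomisticToContinuum.FouriersLaw.Cruxes.SuperadditiveResistance.CruxPosition

end
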